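import Literature.NumberTheory.ComplexMultiplication.CMTypeRankFixedVectorCriteria
import Literature.NumberTheory.ComplexMultiplication.CMTypeRankForeignQuadraticSlot
import Literature.NumberTheory.ComplexMultiplication.SharedImaginaryQuadraticDegenerate
import Literature.NumberTheory.ComplexMultiplication.PartialConjugationOfOneConjugate
import Literature.AlgebraicGeometry.Pohlmann1968.NondegenerateCMAlgebraTypes
import HarnessLib

/-!
# A sextic CM field through an imaginary quadratic field `k` against a field avoiding `k`: no common constituent as
# soon as its Galois closure escapes the other closure joined with `k` (criterion (λ) for CM fields)

Companion of `NumberTheory/ComplexMultiplication/CMTypeRankFixedVectorCriteria` (criterion (λ): if a set `S ⊆ G` fixes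
the slot `E_j` pointwise, every `S`-fixed vector of `U(Φ_i)` is a `χ`-eigenvector and `U(Φ_j)` has no `χ`-eigenvector, then
the slots `i, j` have NO COMMON CONSTITUENT — on Hodge groups `Hg(A_i × A_j) = Hg(A_i) × Hg(A_j)` and, block by block,
`Hg(∏ A) = ∏ Hg`), of `…/CMTypeRankForeignQuadraticSlot` (the stabiliser of an imaginary quadratic field `k` NOT embedding
in `K_j` is transitive on `Hom(K_j, ℂ)`, so `U(Φ_j)` has no `χ_k`-eigenvector) and of `…/PartialConjugationOfOneConjugate`
(the one-sided gluing engine `exists_ringEquiv_apply_eq_of_normal_left`).  Here `G = Aut(ℂ)` and the slot `i` carries a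
SEXTIC CM field `K_i ⊇ e(k)`, `k` imaginary quadratic (the cyclic sextic fields `k·F` and the non-Galois `k·F` with
Galois closure of degree `12` — the CM fields of the simple CM abelian threefolds that are not of pair-flip type):

* `exists_ringEquiv_apply_eq_and_smul_eq_of_quadratic` — FIBRE TRANSITIVITY: for a normal `M ≤ ℂ` of finite degree
  containing `s(e(k))` but not `s(K_i)`, the automorphisms of `ℂ` fixing `M` pointwise act transitively on the embeddings
  `t : K_i → ℂ` with `t|_k = s|_k` (`M ∩ s(K_i)` has even degree dividing `6`, is not `s(K_i)`, hence is `s(e(k))`, fixed by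
  any `g` with `g ∘ s = t`; glue `g⁻¹|_M` with `id|_{s(K_i)}`);
* `smul_mem_of_normal`, `forall_not_forall_apply_mem_of_not_le` — automorphisms of `ℂ` preserve a normal subfield of
  finite degree; if `L_i ⊄ M` then NO embedding of `K_i` lands in `M`;
* **`pairwise_of_quadratic_sextic`** — criterion (λ) for CM fields: if `[K_i : ℚ] = 6`, `e : k → K_i` with `[k : ℚ] = 2`,
  `k` totally complex, the Galois closure `L_i` of `K_i` is NOT contained in `L_j · k̃` (`k̃` the image of `k`), and `k` does
  NOT embed in `K_j`, then `U(Φ_i)` and `U(Φ_j)` have no common constituent, in both orders — for ALL types `Φ_i`, `Φ_j`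
  and with nothing else asked of `K_j` (`L_i` and `L_j` may well share an imaginary quadratic field other than `k`).
  Mechanism: with `S = Aut(ℂ/L_j k̃)`, an `S`-fixed odd weight on `Hom(K_i, ℂ)` is constant on the two fibres over
  `Hom(k, ℂ)` (fibre transitivity), i.e. a multiple of the `k`-sign vector, a `χ_k`-eigenvector (`ksign_smul`); and
  `U(Φ_j)` has no `χ_k`-eigenvector (`eq_zero_of_eigen_of_transitive`, `exists_ringEquiv_smul_eq_of_isEmpty`).

Theorems only; no definition, no named fact, no `sorry`.  Cell `pub-hodgecm2` (COR-CM), count-neutral own lane (seat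
b16); an unconditional statement about Mumford–Tate groups of CM abelian varieties, not a step of the summit chain.

## References
* [Gordon1999HodgeAVSurvey] B. B. Gordon, *A survey of the Hodge conjecture for abelian varieties*, §3 Theorem (Imai,
  Murty) with proof; 7.5–7.7.
* [MoonenZarhin1999LowDim] B. Moonen, Yu. Zarhin, Math. Ann. 315 (1999) 711–733, Thm. (0.2) (a), (3.1), (3.9).
* [Lang2002] S. Lang, *Algebra*, GTM 211, VI §1 Thm. 1.1, Cor. 1.6, Thm. 1.12, Thm. 1.14; V §2 Thm. 2.8.
* [Shimura1998] G. Shimura, *Abelian Varieties with Complex Multiplication and Modular Functions*, §8.4 (2), §18.1.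
-/

noncomputable section

open scoped BigOperators
open IntermediateField NumberField Module

namespace Literature.NumberTheory.ComplexMultiplication

/-! ### §1 Normal subfields of `ℂ` are stable under `Aut(ℂ)`; fibre transitivity over an imaginary quadratic field -/

section Galois

/-- **An automorphism of `ℂ` maps a normal subfield of finite degree into itself** (the conjugates of an element of a
normal extension lie in it). [cite: Lang2002, V §3 Thm. 3.3] -/
theorem smul_mem_of_normal (M : IntermediateField ℚ ℂ) [@Normal ℚ M _ _ (IntermediateField.algebra' M)]
    (σ : ℂ ≃+* ℂ) {x : ℂ} (hx : x ∈ M) : σ x ∈ M := by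
  letI iM : Algebra ℚ ↥M := IntermediateField.algebra' M
  let σQ : ℂ ≃ₐ[ℚ] ℂ := AlgEquiv.ofRingEquiv (f := σ) fun q => by rw [eq_ratCast]; exact map_ratCast σ q
  have h : ((σQ.restrictNormal ↥M ⟨x, hx⟩ : ↥M) : ℂ) = σ x := AlgEquiv.restrictNormal_commutes σQ (↥M) ⟨x, hx⟩
  rw [← h]
  exact Subtype.mem _

variable {I : Type} {K : I → Type} [∀ i, Field (K i)] [∀ i, NumberField (K i)]

/-- **If the Galois closure `L_i` of `K_i` is not contained in a normal `M`, then NO embedding of `K_i` lands in `M`**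
(the images of the embeddings are conjugate under `Aut(ℂ)`, which preserves `M`). [cite: Lang2002, V §3 Thm. 3.3] -/
theorem forall_not_forall_apply_mem_of_not_le (i : I) (M : IntermediateField ℚ ℂ)
    [@Normal ℚ M _ _ (IntermediateField.algebra' M)] (hL : ¬ normalClosure ℚ (K i) ℂ ≤ M) (s : K i →+* ℂ) :
    ¬ ∀ z : K i, s z ∈ M := by
  intro hs
  haveI := Literature.AlgebraicGeometry.Pohlmann1968.isPretransitive_ringEquiv_complex (K := K i)
  refine hL (normalClosure_le_iff.2 fun f y hy => ?_)
  obtain ⟨z, rfl⟩ := AlgHom.mem_fieldRange.1 hy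
  obtain ⟨g, hg⟩ := MulAction.exists_smul_eq (ℂ ≃+* ℂ) s f.toRingHom
  have e1 : f z = g (s z) := by
    have := RingHom.congr_fun hg z
    rw [ringEquiv_smul_apply] at this
    exact this.symm
  change f z ∈ M
  rw [e1]
  exact smul_mem_of_normal M g (hs z)

variable {k : Type} [Field k] [NumberField k]

/-- The image of an embedding of a number field is finite over `ℚ`. [folklore] -/
private theorem finiteDimensional_fieldRange₄₄ {F : Type} [Field F] [NumberField F] (f : F →ₐ[ℚ] ℂ) :
    FiniteDimensional ℚ f.fieldRange :=
  LinearEquiv.finiteDimensional (AlgEquiv.ofInjectiveField f).toLinearEquiv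

/-- A subfield of a finite extension (inside `ℂ`) is finite. [folklore] -/
private theorem finiteDimensional_of_le₄₄ {E E' : IntermediateField ℚ ℂ} [FiniteDimensional ℚ E] (h : E' ≤ E) :
    FiniteDimensional ℚ E' :=
  FiniteDimensional.of_injective (IntermediateField.inclusion h).toLinearMap (IntermediateField.inclusion_injective h)

/-- **Fibre transitivity.**  Let `K_i ⊇ e(k)` be sextic, `k` quadratic, `M ≤ ℂ` normal of finite degree with
`s(e(k)) ⊆ M` but `s(K_i) ⊄ M`.  Then for every embedding `t` with `t ∘ e = s ∘ e` some automorphism of `ℂ` FIXING `M`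
POINTWISE maps `s` to `t`: `M ∩ s(K_i)` has even degree dividing `6` and is not `s(K_i)`, so it is the quadratic field
`s(e(k))`, on which any `g` with `g ∘ s = t` is the identity; glue `g⁻¹` on `M` with the identity on `s(K_i)`
(`exists_ringEquiv_apply_eq_of_normal_left`) and compose with `g`. [cite: Lang2002, VI §1 Thm. 1.12 and Thm. 1.14] -/
theorem exists_ringEquiv_apply_eq_and_smul_eq_of_quadratic {i : I} (hk : finrank ℚ k = 2)
    (h6 : finrank ℚ (K i) = 6) (e : k →+* K i) (M : IntermediateField ℚ ℂ) [FiniteDimensional ℚ M]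
    [@Normal ℚ M _ _ (IntermediateField.algebra' M)] {s t : K i →+* ℂ} (hst : t.comp e = s.comp e)
    (hkM : ∀ z : k, s (e z) ∈ M) (hKM : ¬ ∀ z : K i, s z ∈ M) :
    ∃ τ : ℂ ≃+* ℂ, (∀ y : ℂ, y ∈ M → τ y = y) ∧ τ • s = t := by
  classical
  haveI := Literature.AlgebraicGeometry.Pohlmann1968.isPretransitive_ringEquiv_complex (K := K i)
  obtain ⟨g, hg⟩ := MulAction.exists_smul_eq (ℂ ≃+* ℂ) s t
  -- the fields `S = s(K_i) ⊇ D = M ∩ S ⊇ Q = s(e(k))`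
  set S : IntermediateField ℚ ℂ := s.toRatAlgHom.fieldRange with hS_def
  set Q : IntermediateField ℚ ℂ := (s.comp e).toRatAlgHom.fieldRange with hQ_def
  haveI : FiniteDimensional ℚ ↥S := finiteDimensional_fieldRange₄₄ _
  haveI : FiniteDimensional ℚ ↥Q := finiteDimensional_fieldRange₄₄ _
  haveI : FiniteDimensional ℚ ↥(M ⊓ S) := finiteDimensional_of_le₄₄ (inf_le_right : M ⊓ S ≤ S)
  have h6S : finrank ℚ ↥S = 6 := ((AlgEquiv.ofInjectiveField s.toRatAlgHom).toLinearEquiv.finrank_eq).symm.trans h6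
  have h2Q : finrank ℚ ↥Q = 2 :=
    ((AlgEquiv.ofInjectiveField (s.comp e).toRatAlgHom).toLinearEquiv.finrank_eq).symm.trans hk
  have hQD : Q ≤ M ⊓ S := by
    intro y hy
    obtain ⟨z, rfl⟩ := AlgHom.mem_fieldRange.1 hy
    exact ⟨hkM z, AlgHom.mem_fieldRange.2 ⟨e z, rfl⟩⟩
  have hDS : M ⊓ S ≤ S := inf_le_right
  have hDne : M ⊓ S ≠ S := fun h => hKM fun z => by
    have hz : s z ∈ S := AlgHom.mem_fieldRange.2 ⟨z, rfl⟩
    rw [← h] at hz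
    exact hz.1
  -- `[D : ℚ]` is even, divides `6`, and is `< 6`: it is `2`, so `D = Q`
  have hdvd6 : finrank ℚ ↥(M ⊓ S) ∣ 6 := h6S ▸ IntermediateField.finrank_dvd_of_le_right hDS
  have h2dvd : 2 ∣ finrank ℚ ↥(M ⊓ S) := h2Q ▸ IntermediateField.finrank_dvd_of_le_right hQD
  have hne6 : finrank ℚ ↥(M ⊓ S) ≠ 6 := fun h =>
    hDne (IntermediateField.eq_of_le_of_finrank_eq hDS (h.trans h6S.symm))
  have hpos : 0 < finrank ℚ ↥(M ⊓ S) := Module.finrank_pos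
  have hle6 : finrank ℚ ↥(M ⊓ S) ≤ 6 := Nat.le_of_dvd (by norm_num) hdvd6
  obtain ⟨m, hm⟩ := h2dvd
  have hD2 : finrank ℚ ↥(M ⊓ S) = 2 := by interval_cases h : finrank ℚ ↥(M ⊓ S) <;> omega
  have hQeq : Q = M ⊓ S := IntermediateField.eq_of_le_of_finrank_eq hQD (h2Q.trans hD2.symm)
  -- `g⁻¹` fixes `M ∩ S = Q` pointwise
  have hginv : ∀ x : ℂ, x ∈ M → x ∈ S → g⁻¹ x = x := by
    intro x hxM hxS
    have hxQ : x ∈ Q := hQeq ▸ (⟨hxM, hxS⟩ : x ∈ M ⊓ S)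
    obtain ⟨z, rfl⟩ := AlgHom.mem_fieldRange.1 hxQ
    change g⁻¹ (s (e z)) = s (e z)
    have h1 : g (s (e z)) = t (e z) := by
      have := RingHom.congr_fun hg (e z)
      rw [ringEquiv_smul_apply] at this
      exact this
    have h2 : t (e z) = s (e z) := RingHom.congr_fun hst z
    rw [RingAut.inv_apply, RingEquiv.symm_apply_eq, h1, h2]
  -- glue: `τ₀ = g⁻¹` on `M`, `τ₀ = id` on `S`; then `τ = g τ₀`
  obtain ⟨τ₀, hτ₀M, hτ₀S⟩ := exists_ringEquiv_apply_eq_of_normal_left (A := M) (M := S) g⁻¹ hginv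
  refine ⟨g * τ₀, fun y hy => ?_, RingHom.ext fun z => ?_⟩
  · rw [RingAut.mul_apply, hτ₀M y hy, RingAut.inv_apply, RingEquiv.apply_symm_apply]
  · have h1 := RingHom.congr_fun hg z
    rw [ringEquiv_smul_apply] at h1
    have h2 : τ₀ (s z) = s z := hτ₀S (s z) (AlgHom.mem_fieldRange.2 ⟨z, rfl⟩)
    rw [ringEquiv_smul_apply, RingAut.mul_apply, h2, h1]

end Galois

/-! ### §2 Criterion (λ) for CM fields: a sextic field through `k` against a field avoiding `k` -/

section Lambda

open Literature.AlgebraicGeometry.Pohlmann1968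
open Literature.AlgebraicGeometry.Motives (CMType)

variable {I : Type} {K : I → Type} [∀ i, Field (K i)] [∀ i, NumberField (K i)] [∀ i, IsCMField (K i)]
variable {k : Type} [Field k] [NumberField k] [IsTotallyComplex k]

open scoped Classical in
/-- **Criterion (λ) for CM fields.**  Let `[K_i : ℚ] = 6`, `e : k → K_i` with `[k : ℚ] = 2`, `k` totally complex;
suppose the Galois closure of `K_i` is NOT contained in `L_j · k̃` (`L_j` the Galois closure of `K_j`, `k̃` the image of
`k`) and `k` does NOT embed in `K_j`.  Then `U(Φ_i)` and `U(Φ_j)` have no common constituent, in both orders, for all CM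
types `Φ_i`, `Φ_j`: the odd weights on `Hom(K_i, ℂ)` fixed by `Aut(ℂ/L_j k̃)` are the multiples of the `k`-sign vector —
`χ_k`-eigenvectors — and `U(Φ_j)` has no `χ_k`-eigenvector. [cite: MoonenZarhin1999LowDim, Thm. (0.2) (a) and (3.9)]
[cite: Gordon1999HodgeAVSurvey, §3 Theorem (proof)] -/
theorem pairwise_of_quadratic_sextic {Φ : ∀ i, CMType (K i)} {i j : I} (hk : finrank ℚ k = 2)
    (h6 : finrank ℚ (K i) = 6) (e : k →+* K i)
    (hL : ¬ normalClosure ℚ (K i) ℂ ≤ normalClosure ℚ (K j) ℂ ⊔ normalClosure ℚ k ℂ)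
    (hkj : IsEmpty (k →+* K j)) :
    (∀ P : Submodule ℚ ((K i →+* ℂ) → ℚ), P ≤ antiSpan (ℂ ≃+* ℂ) (Φ i).1 →
      (∀ g : ℂ ≃+* ℂ, ∀ f ∈ P, (fun x => f (g • x)) ∈ P) →
      ∀ T : ((K i →+* ℂ) → ℚ) →ₗ[ℚ] ((K j →+* ℂ) → ℚ),
        (∀ g : ℂ ≃+* ℂ, ∀ f ∈ P, T (fun x => f (g • x)) = fun y => T f (g • y)) →
        (∀ f ∈ P, T f ∈ antiSpan (ℂ ≃+* ℂ) (Φ j).1) → (∀ f ∈ P, T f = 0 → f = 0) → P = ⊥) ∧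
    (∀ P : Submodule ℚ ((K j →+* ℂ) → ℚ), P ≤ antiSpan (ℂ ≃+* ℂ) (Φ j).1 →
      (∀ g : ℂ ≃+* ℂ, ∀ f ∈ P, (fun x => f (g • x)) ∈ P) →
      ∀ T : ((K j →+* ℂ) → ℚ) →ₗ[ℚ] ((K i →+* ℂ) → ℚ),
        (∀ g : ℂ ≃+* ℂ, ∀ f ∈ P, T (fun x => f (g • x)) = fun y => T f (g • y)) →
        (∀ f ∈ P, T f ∈ antiSpan (ℂ ≃+* ℂ) (Φ i).1) → (∀ f ∈ P, T f = 0 → f = 0) → P = ⊥) := by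
  -- the normal field `M = L_j · k̃` and its pointwise stabiliser `S`
  haveI hNj : ∀ j : I, @Normal ℚ ↥(normalClosure ℚ (K j) ℂ) _ _ (IntermediateField.algebra' _) :=
    normal_normalClosure_complex
  haveI hNk : @Normal ℚ ↥(normalClosure ℚ k ℂ) _ _ (IntermediateField.algebra' _) :=
    normal_normalClosure_complex (I := Unit) (K := fun _ => k) ()
  set M : IntermediateField ℚ ℂ := normalClosure ℚ (K j) ℂ ⊔ normalClosure ℚ k ℂ with hM_def
  haveI hNM : @Normal ℚ ↥M _ _ (IntermediateField.algebra' M) := by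
    rw [hM_def]; infer_instance
  obtain ⟨ι₀⟩ : Nonempty (k →+* ℂ) := inferInstance
  set ρ : ℂ ≃+* ℂ := starRingAut with hρ_def
  have hρι : ρ • ι₀ ≠ ι₀ := fun h => by
    rw [conj_smul_eq_conjugate] at h
    exact IsTotallyComplex.complexEmbedding_not_isReal ι₀ (ComplexEmbedding.isReal_iff.2 h)
  let χ : (ℂ ≃+* ℂ) → ℚ := fun g => if g • ι₀ = ι₀ then 1 else -1
  have hχρ : χ ρ = -1 := if_neg hρι
  -- embeddings of `K_i`: `k`-part inside `M`, whole image never inside `M`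
  have hkM : ∀ (x : K i →+* ℂ) (z : k), x (e z) ∈ M := fun x z =>
    (le_sup_right : normalClosure ℚ k ℂ ≤ M)
      (apply_mem_normalClosure (I := Unit) (K := fun _ => k) () (x.comp e) z)
  have hKM : ∀ x : K i →+* ℂ, ¬ ∀ z : K i, x z ∈ M := forall_not_forall_apply_mem_of_not_le i M hL
  refine pairwise_of_fixed_subset_eigenline (G := ℂ ≃+* ℂ) (Φ := fun i => (Φ i).1)
    {τ : ℂ ≃+* ℂ | ∀ y : ℂ, y ∈ M → τ y = y} χ ?_ ?_ ?_
  · -- `S` fixes every embedding of `K_j`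
    intro τ hτ t
    exact RingHom.ext fun x => by
      rw [ringEquiv_smul_apply]
      exact hτ _ ((le_sup_left : normalClosure ℚ (K j) ℂ ≤ M) (apply_mem_normalClosure j t x))
  · -- an `S`-fixed vector of `U(Φ_i)` is a multiple of the `k`-sign vector
    intro f hf hfS g
    -- fibre constancy: `y ∘ e = x ∘ e ⟹ f y = f x`
    have hfib : ∀ x y : K i →+* ℂ, y.comp e = x.comp e → f y = f x := by
      intro x y hxy
      obtain ⟨τ, hτM, hτx⟩ := exists_ringEquiv_apply_eq_and_smul_eq_of_quadratic hk h6 e M hxy (hkM x) (hKM x)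
      have := congrFun (hfS τ hτM) x
      rw [hτx] at this
      exact this
    -- a base point `x₀` over `ι₀`
    obtain ⟨x₁⟩ : Nonempty (K i →+* ℂ) := inferInstance
    obtain ⟨x₀, hx₀⟩ : ∃ x₀ : K i →+* ℂ, x₀.comp e = ι₀ := by
      by_cases h1 : x₁.comp e = ι₀
      · exact ⟨x₁, h1⟩
      · refine ⟨ρ • x₁, ?_⟩
        have hs := ksign_smul hk ι₀ e ρ x₁
        rw [if_neg hρι, if_neg h1] at hs
        by_contra h2
        rw [if_neg h2] at hs
        norm_num at hs
    -- `f x = sign(x) · f x₀`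
    have hval : ∀ x : K i →+* ℂ, f x = (if x.comp e = ι₀ then (1 : ℚ) else -1) * f x₀ := by
      intro x
      by_cases hx : x.comp e = ι₀
      · rw [if_pos hx, one_mul]
        exact hfib x₀ x (hx.trans hx₀.symm)
      · rw [if_neg hx]
        have hs := ksign_smul hk ι₀ e ρ x
        rw [if_neg hρι, if_neg hx] at hs
        have hρx : (ρ • x).comp e = ι₀ := by
          by_contra h2
          rw [if_neg h2] at hs
          norm_num at hs
        have h1 : f (ρ • x) = f x₀ := hfib x₀ (ρ • x) (hρx.trans hx₀.symm)
        have h2 : f (ρ • x) = -f x := apply_rho_smul_of_mem_antiSpan (isCMTypeWith_conj (Φ i)) hf x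
        linarith
    funext x
    rw [Pi.smul_apply, smul_eq_mul, hval (g • x), hval x, ksign_smul hk ι₀ e g x]
    ring
  · -- `U(Φ_j)` has no `χ_k`-eigenvector: the stabiliser of `k` is transitive on `Hom(K_j, ℂ)`
    intro f hf heig
    refine eq_zero_of_eigen_of_transitive (G := ℂ ≃+* ℂ) χ heig (fun x y => ?_) (g₀ := ρ) (by rw [hχρ]; norm_num)
    obtain ⟨τ, hτk, hτx⟩ := exists_ringEquiv_smul_eq_of_isEmpty hk hkj x y
    exact ⟨τ, if_pos (hτk ι₀), hτx⟩

end Lambda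

end Literature.NumberTheory.ComplexMultiplication

end
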